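/-
Copyright (c) 2026 the pub-hodgecm-mathlib formalisation cell (harness21).  Prover seat hodgecm-mathlib-K2E4-p14 (g5), Track B ∕ K2-LIT, h413 =
`stmt-HodgeConjecture-24833`, line `K2_E1_TraceFormulaBeta`, campaign «EIS-RANK-ONE» rung R6f(ii); DEAL «EIS-R6-CM» of the dealer K2E1-plan (g3) 2026-09-04T05:26:42Z,
cut (C1): the DISCHARGE of the four weight-level → idele-class hypotheses `hδ₁…hδ₄` (and `hi₁…hi₄`) of ★ `K2E1MaassSelbergU.maassSelberg_inner_truncation_three` for FLAT SECTIONS.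
-/
import Summits.HodgeConjecture.HodgeConjecture.Theorems.K2E1MaassSelbergU                      -- ★ p857614 (this seat): the hypothesis-first relation, idele evaluations
import Summits.HodgeConjecture.HodgeConjecture.Theorems.K2E1EisensteinPairingUnfoldedWeight    -- ★ p857604 (K2E4-p11 g3): (δ) the `B(F)`-weight-level entry at `N = 3`
import Summits.HodgeConjecture.HodgeConjecture.Theorems.K2E1BorelEisensteinUDefs               -- ★ p857359 (K2E1-p08 g4): `flatSectionU`
import Literature.NumberTheory.Automorphic.UnitaryGroupCuspIntegralSiegelMajorant              -- ★ `borelHeight_mul_of_mem_comap_standardMaximalCompactGL` (`H(g k) = H(g)`, `k ∈ K_U`)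
import Literature.NumberTheory.Automorphic.UnitaryGroupTorusSiegelIntegral                     -- ★ `borelHeight_pos`
import HarnessLib

/-!
# K2·E1 — `K2E1MaassSelbergBracketsThree`: THE FOUR MAASS–SELBERG BRACKETS OF `U(J₃)` FOR FLAT SECTIONS, FROM THE `B(F)`-WEIGHT LEVEL TO THE IDELE CLASS GROUP
# (campaign «EIS-RANK-ONE», rung R6f(ii), cut (C1) of «EIS-R6-CM»: the `hδᵢ`∕`hiᵢ` inputs of ★ `maassSelberg_inner_truncation_three`, discharged over ★ (δ) p857604)

Track B ∕ K2-LIT, crux h413 = `stmt-HodgeConjecture-24833`, route of record `HCCMUnconditional`; cell `hodgecm-mathlib`, squad K2, ENGINE E1.  Prover seat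
`hodgecm-mathlib-K2E4-p14` (g5); DEAL «EIS-R6-CM» of the dealer K2E1-plan (g3) 2026-09-04T05:26:42Z (cut (C1) first, as ruled).  THEOREMS ONLY (no `def`, no `instance`, no
notation, no named-fact hypothesis, no `sorry`); lane `--supports stmt-HodgeConjecture-24833 --as helper` (count-neutral).  Closes no socket.  Generic quadratic `(F, E, c)` with
`[E:F] = 2`, `c² = 1`, `c ≠ 1` (nothing CM-specific: CM enters (C2) through ★ R2 `summable_eisensteinSeriesU_flatSectionU_cm_three`).

THE MATHEMATICS [MoeglinWaldspurger1995, II.1.5, IV.2.1–IV.2.3; Arthur1980TraceFormulaII, §4; Garrett2018, §11.3].  `G = U(J₃)(𝔸_F)`, `H` the Borel height, `K_U` the standard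
maximal compact, `d₀ : T(𝔸_F) → 𝕀_E` the first diagonal coordinate.  For a height cut-off `P ⊆ ℝ≥0` and two FLAT SECTIONS `f_a = α·H^a`, `f′_{a′} = α′·H^{a′}` (★ p857359
`flatSectionU`; `α, α′` Borel, bounded, left-`N(𝔸)`- and left-`B(F)`-invariant), the Maass–Selberg bracket integrand `Ψ = 𝟙_P(H)·f_a·conj f′_{a′}` has, along the torus,
`H(t k) = H(t) = ‖d₀ t‖` (★ `borelHeight_mul_of_mem_comap_standardMaximalCompactGL`, ★ p857484 `borelHeight_coe_eq_ideleNorm_diagUnit`) and `conj (‖d₀ t‖^{a′}) = ‖d₀ t‖^{conj a′}`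
(★ `conj_ofReal_cpow_of_nonneg`, inlined),
so its `K_U`-average is `𝟙_P(‖d₀ t‖)·‖d₀ t‖^{a + conj a′}·Ξ(d₀ t)` as soon as **(hΞ) the `K_U`-average of `α·conj α′` along the torus is a function `Ξ` of `d₀ t`** — the ONE
structural hypothesis (for sections of `Ind χ`, `Ind χ′` it is `⟨α,α′⟩_{K_U}·(χ·conj χ′)♭` when `χ·conj χ′` is trivial on `U(1) = ker d₀`, ★ p857588 §3; when it is not, ★ p857588 §2 makes the
bracket vanish and the consumer runs ★ FILE 2 with `Ψᵢ := 0`).  Then ★ (δ) p857604 gives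
  **`∫ (β g)·Ψ(g) dν_G = K · ∫_{𝓕} (‖x‖·‖x‖)⁻¹ • 𝟙_P(‖x‖)·‖x‖^{a + conj a′}·Ξ(x) dν_I`**, with `(β)·Ψ ∈ L¹(ν_G)`,
for ONE `K > 0` and every covering weight `β` of `B(F)♯`, under the honest finiteness `∫⁻_𝓕 (‖x‖·‖x‖)⁻¹·𝟙_P·‖x‖^{Re(a+ā′)}·C_α C_α′ < ∞` (§1, the master lemma
`exists_integral_weight_smul_cutoff_flatSectionU_mul_conj_eq_three`).  §2 instantiates at `P = Iic T` and `P = Ioi T` in the EXACT token shape of ★ FILE 2's `hδ₁…hδ₄`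
(`{x | (‖x‖:ℝ) ≤ (T:ℝ)}`, `{x | (T:ℝ) < (‖x‖:ℝ)}`), discharging the finiteness by ★ p857444 `setLIntegral_indicator_ideleNorm_rpow_eq` (`Re(a + ā′) > 2`) resp. ★ p857517
`setLIntegral_indicator_lt_rpow_neg` (`Re(a + ā′) < 2`): for the four brackets `(α,a,α′,a′) = (φ,z,φ′,z′), (φ,z,φ̃′,2−z′), (φ̃,2−z,φ′,z′), (φ̃,2−z,φ̃′,2−z′)` the exponents
`a + conj a′` are `s₁+2, s₂+2, −s₂+2, −s₁+2` with `s₁ = z + conj z′ − 2`, `s₂ = z − conj z′`.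
HONEST LABEL: HC_CM is proved only modulo the 7 printed citations (2 remaining named inputs: hLiu418 = `stmt-HodgeConjecture-24832`, h413 = `stmt-HodgeConjecture-24833`) until rung 0
closes; this file asserts no named fact and closes no socket.
References: [MoeglinWaldspurger1995] C. Mœglin, J.-L. Waldspurger, *Spectral Decomposition and Eisenstein Series* (1995), II.1.5, IV.2.1–IV.2.3 · [Arthur1980TraceFormulaII] J. Arthur,
Compositio Math. 40 (1980), §4 · [Garrett2018] P. Garrett, *Modern Analysis of Automorphic Forms by Example* (2018), §11.3 · [Rogawski1990] §2.2, §7.3.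
-/

set_option autoImplicit false
-- the mandated namespace repeats the single-problem summit's segment (`HodgeConjecture.HodgeConjecture`)
set_option linter.dupNamespace false

noncomputable section

open MeasureTheory Measure NumberField IsDedekindDomain Set MulAction
open scoped ENNReal NNReal ComplexConjugate
open Literature.MeasureTheory.Group Literature.NumberTheory
open Literature.NumberTheory.Automorphic Literature.NumberTheory.Automorphic.UnitaryGroup AdelicGroupData
open Summit.HodgeConjecture.HodgeConjecture.Cruxes.H413.K2E1BorelEisensteinU
open Summit.HodgeConjecture.HodgeConjecture.Cruxes.H413.K2E1IdeleClassMellinWeighted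
open Summit.HodgeConjecture.HodgeConjecture.Cruxes.H413.K2E1TorusHeightMellin
open Summit.HodgeConjecture.HodgeConjecture.Cruxes.H413.K2E1BorelParabolicIntegralU2 (borelHeight_coe_eq_ideleNorm_diagUnit)
open Summit.HodgeConjecture.HodgeConjecture.Cruxes.H413.K2E1EisensteinPairingUnfoldedWeight

namespace Summit.HodgeConjecture.HodgeConjecture.Cruxes.H413.K2E1MaassSelbergBracketsThree

variable {F E : Type} [Field F] [NumberField F] [Field E] [NumberField E] [Algebra F E] {c : E ≃ₐ[F] E} {N : ℕ} [NeZero N]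

/-! ## §0 Pointwise: the flat-section bracket integrand along `T(𝔸_F)·K_U` -/

/-- A flat section is its coefficient times the height power of the constant section: `f_a = α · (1·H^a)` — so it is Borel when `α` is. [folklore] -/
theorem measurable_flatSectionU [MeasurableSpace (quasiSplit F E c N).Adelic] [BorelSpace (quasiSplit F E c N).Adelic]
    {α : (quasiSplit F E c N).Adelic → ℂ} (hα : Measurable α) (a : ℂ) : Measurable (flatSectionU α a) := by
  have h1 : Measurable (flatSectionU (fun _ : (quasiSplit F E c N).Adelic => (1 : ℂ)) a) := (continuous_flatSectionU continuous_const a).measurable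
  have h : flatSectionU α a = fun g => α g * flatSectionU (fun _ => (1 : ℂ)) a g := by
    funext g; rw [flatSectionU_apply, flatSectionU_apply, one_mul]
  rw [h]; exact hα.mul h1

/-- **THE BRACKET INTEGRAND AT `t·k`**: with `h₀ = H(t k)`, `𝟙_P(H)·f_a·conj f′_{a′} (t k) = (𝟙_P(h₀)·h₀^{a + conj a′}) · (α(tk)·conj α′(tk))`. [cite: MoeglinWaldspurger1995, II.1.5] -/
theorem cutoff_flatSectionU_mul_conj_apply (P : Set ℝ≥0) (α α' : (quasiSplit F E c N).Adelic → ℂ) (a a' : ℂ) (g : (quasiSplit F E c N).Adelic) :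
    {y : (quasiSplit F E c N).Adelic | borelHeight y ∈ P}.indicator (flatSectionU α a) g * conj (flatSectionU α' a' g) =
      (P.indicator (fun _ => (1 : ℂ)) (borelHeight g) * ((borelHeight g : ℝ) : ℂ) ^ (a + conj a')) * (α g * conj (α' g)) := by
  have hpos : (0 : ℝ) ≤ (borelHeight g : ℝ) := NNReal.coe_nonneg _
  have hne : ((borelHeight g : ℝ) : ℂ) ≠ 0 := Complex.ofReal_ne_zero.2 (ne_of_gt (by exact_mod_cast borelHeight_pos g))
  -- `conj (r ^ w) = r ^ conj w` for the real base `r = H(g) ≥ 0` (`arg r = 0`; ★ `conj_ofReal_cpow_of_nonneg` of `BLZPeriodCocycleInjectivity`, inlined to keep the import closure small)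
  have hconj : conj (((borelHeight g : ℝ) : ℂ) ^ a') = ((borelHeight g : ℝ) : ℂ) ^ conj a' := by
    have harg : ((borelHeight g : ℝ) : ℂ).arg ≠ Real.pi := by
      rw [Complex.arg_ofReal_of_nonneg hpos]; exact Real.pi_pos.ne
    rw [Complex.cpow_conj _ _ harg, Complex.conj_ofReal]
  by_cases hg : borelHeight g ∈ P
  · rw [indicator_of_mem (show g ∈ {y : (quasiSplit F E c N).Adelic | borelHeight y ∈ P} from hg), indicator_of_mem hg, flatSectionU_apply, flatSectionU_apply,
      map_mul, hconj, Complex.cpow_add _ _ hne]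
    ring
  · rw [indicator_of_notMem (show g ∉ {y : (quasiSplit F E c N).Adelic | borelHeight y ∈ P} from hg), indicator_of_notMem hg]
    ring

/-- Its norm: `‖𝟙_P(H)·f_a·conj f′_{a′} (g)‖ ≤ 𝟙_P(H g)·H(g)^{Re(a+ā′)}·C_α·C_α′` for `‖α‖ ≤ C_α`, `‖α′‖ ≤ C_α′`. [cite: MoeglinWaldspurger1995, II.1.5] -/
theorem norm_cutoff_flatSectionU_mul_conj_le (P : Set ℝ≥0) {α α' : (quasiSplit F E c N).Adelic → ℂ} {Cα Cα' : ℝ} (hα : ∀ x, ‖α x‖ ≤ Cα) (hα' : ∀ x, ‖α' x‖ ≤ Cα')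
    (a a' : ℂ) (g : (quasiSplit F E c N).Adelic) :
    ‖{y : (quasiSplit F E c N).Adelic | borelHeight y ∈ P}.indicator (flatSectionU α a) g * conj (flatSectionU α' a' g)‖ ≤
      P.indicator (fun _ => (1 : ℝ)) (borelHeight g) * ((borelHeight g : ℝ) ^ (a + conj a').re * (Cα * Cα')) := by
  have hCα : 0 ≤ Cα := (norm_nonneg _).trans (hα g)
  have hpos : (0 : ℝ) < (borelHeight g : ℝ) := by exact_mod_cast borelHeight_pos g
  rw [cutoff_flatSectionU_mul_conj_apply, norm_mul, norm_mul, norm_mul, Complex.norm_conj, Complex.norm_cpow_eq_rpow_re_of_pos hpos]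
  by_cases hg : borelHeight g ∈ P
  · rw [indicator_of_mem hg, indicator_of_mem hg, norm_one, one_mul, one_mul]
    exact mul_le_mul_of_nonneg_left (mul_le_mul (hα g) (hα' g) (norm_nonneg _) hCα) (Real.rpow_nonneg hpos.le _)
  · rw [indicator_of_notMem hg, indicator_of_notMem hg, norm_zero, zero_mul, zero_mul, zero_mul]

/-! ## §1 The master lemma: `[𝟙_P(H) f_a, f′_{a′}]_β = K · ∫_𝓕 (‖x‖·‖x‖)⁻¹ • 𝟙_P(‖x‖)·‖x‖^{a+ā′}·Ξ` (`U(J₃)`) -/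

section Master

variable [MeasurableSpace (quasiSplit F E c 3).Adelic] [BorelSpace (quasiSplit F E c 3).Adelic]
  [MeasurableSpace (AdeleRing (𝓞 E) E)ˣ] [BorelSpace (AdeleRing (𝓞 E) E)ˣ]

/-- **THE MAASS–SELBERG BRACKET OF TWO FLAT SECTIONS, `B(F)`-WEIGHT LEVEL → IDELE CLASS GROUP (`U(J₃)`).**  `[E:F] = 2`, `c² = 1`, `c ≠ 1`; `ν_G`, `μ_K`, `ν_I` Haar on `G(𝔸)`, `K_U`,
`𝕀_E`; Iwasawa `hBK`; `𝓕` an idele class domain.  There is ONE `K > 0` such that for every covering weight `β` of `B(F)♯`, every Borel cut-off `P ⊆ ℝ≥0`, all Borel bounded left-`N(𝔸)`-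
and left-`B(F)`-invariant coefficients `α, α′`, all exponents `a, a′`, and every Borel bounded `E^×`-invariant `Ξ` with **(hΞ) `∫_{K_U} α(tk)·conj α′(tk) dμ_K = Ξ(d₀ t)` for all
`t ∈ T(𝔸_F)`**, under the finiteness `∫⁻_𝓕 (‖x‖·‖x‖)⁻¹·𝟙_P(‖x‖)·‖x‖^{Re(a+ā′)}·C_α C_α′ dν_I < ∞`:
`(β)·(𝟙_P(H) f_a · conj f′_{a′}) ∈ L¹(ν_G)` and **`∫ (β g)·𝟙_P(H g)·f_a(g)·conj f′_{a′}(g) dν_G = K · ∫_𝓕 (‖x‖·‖x‖)⁻¹ • 𝟙_P(‖x‖)·‖x‖^{a + conj a′}·Ξ(x) dν_I`** — ★ (δ) p857604 with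
`Ψ := 𝟙_P(H)·f_a·conj f′_{a′}`, whose `K_U`-average is computed in §0 (`H(tk) = ‖d₀ t‖`). [cite: MoeglinWaldspurger1995, IV.2.1] [cite: Arthur1980TraceFormulaII, §4] [cite: Garrett2018, §11.3] -/
theorem exists_integral_weight_smul_cutoff_flatSectionU_mul_conj_eq_three (h2 : Module.finrank F E = 2) (hc : c * c = 1) (hc1 : c ≠ 1)
    (νG : Measure (quasiSplit F E c 3).Adelic) [νG.IsHaarMeasure]
    (μK : Measure ((standardMaximalCompactGL 3 E).comap (adelicVal F E c 3 ((StdForm.antidiagonal 3).over E)) : Subgroup (quasiSplit F E c 3).Adelic))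
    [μK.IsHaarMeasure]
    (νI : Measure (AdeleRing (𝓞 E) E)ˣ) [νI.IsHaarMeasure]
    (hBK : ∀ g : (quasiSplit F E c 3).Adelic, ∃ b ∈ borelAdelic F E c 3, ∃ k : (quasiSplit F E c 3).Adelic,
      adelicVal F E c 3 ((StdForm.antidiagonal 3).over E) k ∈ standardMaximalCompactGL 3 E ∧ g = b * k)
    {𝓕 : Set (AdeleRing (𝓞 E) E)ˣ} (h𝓕 : IsIdeleClassDomain E 𝓕) :
    ∃ K : ℝ, 0 < K ∧
      ∀ {β : (quasiSplit F E c 3).Adelic → ℝ≥0∞}, IsCoveringWeight ((arithmeticBorel F E c 3).map (quasiSplit F E c 3).arithmeticSubgroup.subtype) β →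
      ∀ {P : Set ℝ≥0}, MeasurableSet P →
      ∀ {α α' : (quasiSplit F E c 3).Adelic → ℂ}, Measurable α → Measurable α' →
        (∀ (n : unipotentInBorel F E c 3) (y : (quasiSplit F E c 3).Adelic), α (((n : borelAdelic F E c 3) : (quasiSplit F E c 3).Adelic) * y) = α y) →
        (∀ (n : unipotentInBorel F E c 3) (y : (quasiSplit F E c 3).Adelic), α' (((n : borelAdelic F E c 3) : (quasiSplit F E c 3).Adelic) * y) = α' y) →
        (∀ b ∈ arithmeticBorel F E c 3, ∀ y : (quasiSplit F E c 3).Adelic, α ((b : (quasiSplit F E c 3).Adelic) * y) = α y) →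
        (∀ b ∈ arithmeticBorel F E c 3, ∀ y : (quasiSplit F E c 3).Adelic, α' ((b : (quasiSplit F E c 3).Adelic) * y) = α' y) →
      ∀ {Cα Cα' : ℝ}, (∀ x, ‖α x‖ ≤ Cα) → (∀ x, ‖α' x‖ ≤ Cα') →
      ∀ {a a' : ℂ} {Ξ : (AdeleRing (𝓞 E) E)ˣ → ℂ}, Measurable Ξ → (∀ k ∈ GaloisRepresentations.principalIdeles E, ∀ x, Ξ (k * x) = Ξ x) →
        (∀ t : torusInBorel F E c 3,
          ∫ k, α (((t : borelAdelic F E c 3) : (quasiSplit F E c 3).Adelic) * (k : (quasiSplit F E c 3).Adelic)) *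
              conj (α' (((t : borelAdelic F E c 3) : (quasiSplit F E c 3).Adelic) * (k : (quasiSplit F E c 3).Adelic))) ∂μK =
            Ξ (diagUnit (t : borelAdelic F E c 3).2 0)) →
        ∫⁻ x in 𝓕, (((IdeleClassGroup.ideleNorm E x * IdeleClassGroup.ideleNorm E x)⁻¹ : ℝ≥0) : ℝ≥0∞) *
            ({x : (AdeleRing (𝓞 E) E)ˣ | IdeleClassGroup.ideleNorm E x ∈ P}.indicator
              (fun x => ENNReal.ofReal ((IdeleClassGroup.ideleNorm E x : ℝ) ^ (a + conj a').re * (Cα * Cα'))) x) ∂νI < ∞ →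
        Integrable (fun g => (β g).toReal •
            ({y : (quasiSplit F E c 3).Adelic | borelHeight y ∈ P}.indicator (flatSectionU α a) g * conj (flatSectionU α' a' g))) νG ∧
          ∫ g, (β g).toReal • ({y : (quasiSplit F E c 3).Adelic | borelHeight y ∈ P}.indicator (flatSectionU α a) g * conj (flatSectionU α' a' g)) ∂νG =
            (K : ℂ) * ∫ x in 𝓕, ((IdeleClassGroup.ideleNorm E x : ℝ) * (IdeleClassGroup.ideleNorm E x : ℝ))⁻¹ •
              {x : (AdeleRing (𝓞 E) E)ˣ | IdeleClassGroup.ideleNorm E x ∈ P}.indicator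
                (fun x => ((IdeleClassGroup.ideleNorm E x : ℝ) : ℂ) ^ (a + conj a') * Ξ x) x ∂νI := by
  obtain ⟨K, hK0, hKt, -, hδ⟩ := exists_integral_weight_smul_eq_mul_setIntegral_ideleClass_three h2 hc hc1 νG μK νI hBK h𝓕
  refine ⟨K.toReal, ENNReal.toReal_pos hK0 hKt, ?_⟩
  intro β hβ P hP α α' hαm hα'm hαN hα'N hαB hα'B Cα Cα' hαC hα'C a a' Ξ hΞm hΞK hΞ hfin
  -- the integrand `Ψ`, its density `Φ` and majorant `Φm`
  have hSm : MeasurableSet {y : (quasiSplit F E c 3).Adelic | borelHeight y ∈ P} := measurable_borelHeight hP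
  have hΨm : Measurable fun g => {y : (quasiSplit F E c 3).Adelic | borelHeight y ∈ P}.indicator (flatSectionU α a) g * conj (flatSectionU α' a' g) :=
    ((measurable_flatSectionU hαm a).indicator hSm).mul (Complex.continuous_conj.measurable.comp (measurable_flatSectionU hα'm a'))
  have hΨN : ∀ (n : unipotentInBorel F E c 3) (y : (quasiSplit F E c 3).Adelic),
      {y : (quasiSplit F E c 3).Adelic | borelHeight y ∈ P}.indicator (flatSectionU α a) (((n : borelAdelic F E c 3) : (quasiSplit F E c 3).Adelic) * y) *
          conj (flatSectionU α' a' (((n : borelAdelic F E c 3) : (quasiSplit F E c 3).Adelic) * y)) =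
        {y : (quasiSplit F E c 3).Adelic | borelHeight y ∈ P}.indicator (flatSectionU α a) y * conj (flatSectionU α' a' y) := by
    intro n y
    rw [cutoff_flatSectionU_mul_conj_apply, cutoff_flatSectionU_mul_conj_apply, borelHeight_unipotent_mul ((mem_unipotentInBorel_iff _).1 n.2), hαN n y, hα'N n y]
  have hΨB : ∀ b ∈ arithmeticBorel F E c 3, ∀ y : (quasiSplit F E c 3).Adelic,
      {y : (quasiSplit F E c 3).Adelic | borelHeight y ∈ P}.indicator (flatSectionU α a) ((b : (quasiSplit F E c 3).Adelic) * y) *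
          conj (flatSectionU α' a' ((b : (quasiSplit F E c 3).Adelic) * y)) =
        {y : (quasiSplit F E c 3).Adelic | borelHeight y ∈ P}.indicator (flatSectionU α a) y * conj (flatSectionU α' a' y) := by
    intro b hb y
    rw [cutoff_flatSectionU_mul_conj_apply, cutoff_flatSectionU_mul_conj_apply, borelHeight_arithmeticBorel_mul hb, hαB b hb y, hα'B b hb y]
  have hIm : Measurable fun x : (AdeleRing (𝓞 E) E)ˣ => IdeleClassGroup.ideleNorm E x := (continuous_ideleNorm_holds E).measurable
  have hSIm : MeasurableSet {x : (AdeleRing (𝓞 E) E)ˣ | IdeleClassGroup.ideleNorm E x ∈ P} := hIm hP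
  have hpowm : Measurable fun x : (AdeleRing (𝓞 E) E)ˣ => ((IdeleClassGroup.ideleNorm E x : ℝ) : ℂ) ^ (a + conj a') :=
    (Complex.measurable_ofReal.comp hIm.coe_nnreal_real).pow_const _
  have hΦm' : Measurable fun x => {x : (AdeleRing (𝓞 E) E)ˣ | IdeleClassGroup.ideleNorm E x ∈ P}.indicator
      (fun x => ((IdeleClassGroup.ideleNorm E x : ℝ) : ℂ) ^ (a + conj a') * Ξ x) x := (hpowm.mul hΞm).indicator hSIm
  have hΦK : ∀ k ∈ GaloisRepresentations.principalIdeles E, ∀ x,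
      {x : (AdeleRing (𝓞 E) E)ˣ | IdeleClassGroup.ideleNorm E x ∈ P}.indicator (fun x => ((IdeleClassGroup.ideleNorm E x : ℝ) : ℂ) ^ (a + conj a') * Ξ x) (k * x) =
        {x : (AdeleRing (𝓞 E) E)ˣ | IdeleClassGroup.ideleNorm E x ∈ P}.indicator (fun x => ((IdeleClassGroup.ideleNorm E x : ℝ) : ℂ) ^ (a + conj a') * Ξ x) x := by
    intro k hk x
    have hn : IdeleClassGroup.ideleNorm E (k * x) = IdeleClassGroup.ideleNorm E x := by rw [map_mul, ideleNorm_principal hk, one_mul]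
    by_cases hx : IdeleClassGroup.ideleNorm E x ∈ P
    · rw [indicator_of_mem (show k * x ∈ {x : (AdeleRing (𝓞 E) E)ˣ | IdeleClassGroup.ideleNorm E x ∈ P} by rw [Set.mem_setOf_eq, hn]; exact hx),
        indicator_of_mem (show x ∈ {x : (AdeleRing (𝓞 E) E)ˣ | IdeleClassGroup.ideleNorm E x ∈ P} from hx), hn, hΞK k hk x]
    · rw [indicator_of_notMem (show k * x ∉ {x : (AdeleRing (𝓞 E) E)ˣ | IdeleClassGroup.ideleNorm E x ∈ P} by rw [Set.mem_setOf_eq, hn]; exact hx),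
        indicator_of_notMem (show x ∉ {x : (AdeleRing (𝓞 E) E)ˣ | IdeleClassGroup.ideleNorm E x ∈ P} from hx)]
  have hΦmm : Measurable fun x => {x : (AdeleRing (𝓞 E) E)ˣ | IdeleClassGroup.ideleNorm E x ∈ P}.indicator
      (fun x => ENNReal.ofReal ((IdeleClassGroup.ideleNorm E x : ℝ) ^ (a + conj a').re * (Cα * Cα'))) x :=
    (ENNReal.measurable_ofReal.comp ((hIm.coe_nnreal_real.pow_const _).mul_const _)).indicator hSIm
  have hΦmK : ∀ k ∈ GaloisRepresentations.principalIdeles E, ∀ x,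
      {x : (AdeleRing (𝓞 E) E)ˣ | IdeleClassGroup.ideleNorm E x ∈ P}.indicator
          (fun x => ENNReal.ofReal ((IdeleClassGroup.ideleNorm E x : ℝ) ^ (a + conj a').re * (Cα * Cα'))) (k * x) =
        {x : (AdeleRing (𝓞 E) E)ˣ | IdeleClassGroup.ideleNorm E x ∈ P}.indicator
          (fun x => ENNReal.ofReal ((IdeleClassGroup.ideleNorm E x : ℝ) ^ (a + conj a').re * (Cα * Cα'))) x := by
    intro k hk x
    have hn : IdeleClassGroup.ideleNorm E (k * x) = IdeleClassGroup.ideleNorm E x := by rw [map_mul, ideleNorm_principal hk, one_mul]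
    by_cases hx : IdeleClassGroup.ideleNorm E x ∈ P
    · rw [indicator_of_mem (show k * x ∈ {x : (AdeleRing (𝓞 E) E)ˣ | IdeleClassGroup.ideleNorm E x ∈ P} by rw [Set.mem_setOf_eq, hn]; exact hx),
        indicator_of_mem (show x ∈ {x : (AdeleRing (𝓞 E) E)ˣ | IdeleClassGroup.ideleNorm E x ∈ P} from hx), hn]
    · rw [indicator_of_notMem (show k * x ∉ {x : (AdeleRing (𝓞 E) E)ˣ | IdeleClassGroup.ideleNorm E x ∈ P} by rw [Set.mem_setOf_eq, hn]; exact hx),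
        indicator_of_notMem (show x ∉ {x : (AdeleRing (𝓞 E) E)ˣ | IdeleClassGroup.ideleNorm E x ∈ P} from hx)]
  -- along the torus: `H(t k) = ‖d₀ t‖`
  have hHtk : ∀ (t : torusInBorel F E c 3) (k : ((standardMaximalCompactGL 3 E).comap (adelicVal F E c 3 ((StdForm.antidiagonal 3).over E)) :
      Subgroup (quasiSplit F E c 3).Adelic)),
      borelHeight (((t : borelAdelic F E c 3) : (quasiSplit F E c 3).Adelic) * (k : (quasiSplit F E c 3).Adelic)) = IdeleClassGroup.ideleNorm E (diagUnit (t : borelAdelic F E c 3).2 0) := by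
    intro t k
    rw [borelHeight_mul_of_mem_comap_standardMaximalCompactGL k.2, borelHeight_coe_eq_ideleNorm_diagUnit]
  -- the `K_U`-average
  have hAvg : ∀ t : torusInBorel F E c 3,
      ∫ k, {y : (quasiSplit F E c 3).Adelic | borelHeight y ∈ P}.indicator (flatSectionU α a)
            (((t : borelAdelic F E c 3) : (quasiSplit F E c 3).Adelic) * (k : (quasiSplit F E c 3).Adelic)) *
          conj (flatSectionU α' a' (((t : borelAdelic F E c 3) : (quasiSplit F E c 3).Adelic) * (k : (quasiSplit F E c 3).Adelic))) ∂μK =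
        {x : (AdeleRing (𝓞 E) E)ˣ | IdeleClassGroup.ideleNorm E x ∈ P}.indicator (fun x => ((IdeleClassGroup.ideleNorm E x : ℝ) : ℂ) ^ (a + conj a') * Ξ x)
          (diagUnit (t : borelAdelic F E c 3).2 0) := by
    intro t
    simp_rw [cutoff_flatSectionU_mul_conj_apply, hHtk t]
    rw [integral_const_mul, hΞ t]
    by_cases ht : IdeleClassGroup.ideleNorm E (diagUnit (t : borelAdelic F E c 3).2 0) ∈ P
    · rw [indicator_of_mem ht, indicator_of_mem (show diagUnit (t : borelAdelic F E c 3).2 0 ∈ {x : (AdeleRing (𝓞 E) E)ˣ | IdeleClassGroup.ideleNorm E x ∈ P} from ht),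
        one_mul]
    · rw [indicator_of_notMem ht, indicator_of_notMem (show diagUnit (t : borelAdelic F E c 3).2 0 ∉ {x : (AdeleRing (𝓞 E) E)ˣ | IdeleClassGroup.ideleNorm E x ∈ P} from ht),
        zero_mul, zero_mul]
  -- the majorant along `T(𝔸)·K_U`
  have hMaj : ∀ (t : torusInBorel F E c 3) (k : ((standardMaximalCompactGL 3 E).comap (adelicVal F E c 3 ((StdForm.antidiagonal 3).over E)) :
      Subgroup (quasiSplit F E c 3).Adelic)),
      ‖{y : (quasiSplit F E c 3).Adelic | borelHeight y ∈ P}.indicator (flatSectionU α a)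
            (((t : borelAdelic F E c 3) : (quasiSplit F E c 3).Adelic) * (k : (quasiSplit F E c 3).Adelic)) *
          conj (flatSectionU α' a' (((t : borelAdelic F E c 3) : (quasiSplit F E c 3).Adelic) * (k : (quasiSplit F E c 3).Adelic)))‖ₑ ≤
        {x : (AdeleRing (𝓞 E) E)ˣ | IdeleClassGroup.ideleNorm E x ∈ P}.indicator
          (fun x => ENNReal.ofReal ((IdeleClassGroup.ideleNorm E x : ℝ) ^ (a + conj a').re * (Cα * Cα'))) (diagUnit (t : borelAdelic F E c 3).2 0) := by
    intro t k
    rw [← ofReal_norm]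
    refine (ENNReal.ofReal_le_ofReal (norm_cutoff_flatSectionU_mul_conj_le P hαC hα'C a a' _)).trans (le_of_eq ?_)
    rw [hHtk t k]
    by_cases ht : IdeleClassGroup.ideleNorm E (diagUnit (t : borelAdelic F E c 3).2 0) ∈ P
    · rw [indicator_of_mem ht, indicator_of_mem (show diagUnit (t : borelAdelic F E c 3).2 0 ∈ {x : (AdeleRing (𝓞 E) E)ˣ | IdeleClassGroup.ideleNorm E x ∈ P} from ht),
        one_mul]
    · rw [indicator_of_notMem ht, indicator_of_notMem (show diagUnit (t : borelAdelic F E c 3).2 0 ∉ {x : (AdeleRing (𝓞 E) E)ˣ | IdeleClassGroup.ideleNorm E x ∈ P} from ht),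
        zero_mul, ENNReal.ofReal_zero]
  obtain ⟨hI, -, hE⟩ := hδ β hβ _ hΨm hΨN hΨB _ hΦm' hΦK hAvg _ hΦmm hΦmK hMaj hfin
  exact ⟨hI, hE⟩

end Master

/-! ## §2 The two cut-offs `{‖x‖ ≤ T}`, `{T < ‖x‖}` in ★ FILE 2's token shape, finiteness discharged (★ p857444 ∕ ★ p857517) -/

section Instances

variable [MeasurableSpace (quasiSplit F E c 3).Adelic] [BorelSpace (quasiSplit F E c 3).Adelic]
  [MeasurableSpace (AdeleRing (𝓞 E) E)ˣ] [BorelSpace (AdeleRing (𝓞 E) E)ˣ]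

omit [MeasurableSpace (quasiSplit F E c 3).Adelic] [BorelSpace (quasiSplit F E c 3).Adelic] [MeasurableSpace (AdeleRing (𝓞 E) E)ˣ] [BorelSpace (AdeleRing (𝓞 E) E)ˣ] in
/-- The `δ_B⁻¹ = (‖x‖·‖x‖)⁻¹` weight shifts the real exponent of the majorant by `−2`: `(‖x‖·‖x‖)⁻¹·𝟙_P·(‖x‖^{σ} C) = C·𝟙_P·‖x‖^{σ−2}` in `[0,∞]`. [folklore] -/
theorem normSq_inv_mul_indicator_ofReal_rpow (P : Set ℝ≥0) (σ : ℝ) {C : ℝ} (hC : 0 ≤ C) (x : (AdeleRing (𝓞 E) E)ˣ) :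
    (((IdeleClassGroup.ideleNorm E x * IdeleClassGroup.ideleNorm E x)⁻¹ : ℝ≥0) : ℝ≥0∞) *
        {x : (AdeleRing (𝓞 E) E)ˣ | IdeleClassGroup.ideleNorm E x ∈ P}.indicator (fun x => ENNReal.ofReal ((IdeleClassGroup.ideleNorm E x : ℝ) ^ σ * C)) x =
      ENNReal.ofReal C * {x : (AdeleRing (𝓞 E) E)ˣ | IdeleClassGroup.ideleNorm E x ∈ P}.indicator
        (fun x => ENNReal.ofReal ((IdeleClassGroup.ideleNorm E x : ℝ) ^ (σ - 2))) x := by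
  have hr : (0 : ℝ) < (IdeleClassGroup.ideleNorm E x : ℝ) := ideleNorm_real_pos x
  by_cases hx : IdeleClassGroup.ideleNorm E x ∈ P
  · rw [indicator_of_mem (show x ∈ {x : (AdeleRing (𝓞 E) E)ˣ | IdeleClassGroup.ideleNorm E x ∈ P} from hx),
      indicator_of_mem (show x ∈ {x : (AdeleRing (𝓞 E) E)ˣ | IdeleClassGroup.ideleNorm E x ∈ P} from hx), ENNReal.coe_nnreal_eq,
      ← ENNReal.ofReal_mul (by positivity), ← ENNReal.ofReal_mul hC, NNReal.coe_inv, NNReal.coe_mul]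
    congr 1
    rw [show σ = (σ - 2) + 2 by ring, Real.rpow_add hr, Real.rpow_two]
    field_simp
    ring
  · rw [indicator_of_notMem (show x ∉ {x : (AdeleRing (𝓞 E) E)ˣ | IdeleClassGroup.ideleNorm E x ∈ P} from hx),
      indicator_of_notMem (show x ∉ {x : (AdeleRing (𝓞 E) E)ˣ | IdeleClassGroup.ideleNorm E x ∈ P} from hx), mul_zero, mul_zero]

omit [MeasurableSpace (quasiSplit F E c 3).Adelic] [BorelSpace (quasiSplit F E c 3).Adelic] [MeasurableSpace (AdeleRing (𝓞 E) E)ˣ] [BorelSpace (AdeleRing (𝓞 E) E)ˣ] in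
/-- `{‖x‖ ∈ Iic T} = {(‖x‖:ℝ) ≤ (T:ℝ)}` and `{‖x‖ ∈ Ioi T} = {(T:ℝ) < (‖x‖:ℝ)}` (★ FILE 2's idele cut-offs). [folklore] -/
theorem setOf_ideleNorm_mem_Iic_eq (T : ℝ≥0) :
    {x : (AdeleRing (𝓞 E) E)ˣ | IdeleClassGroup.ideleNorm E x ∈ Set.Iic T} = {x : (AdeleRing (𝓞 E) E)ˣ | (IdeleClassGroup.ideleNorm E x : ℝ) ≤ (T : ℝ)} ∧
    {x : (AdeleRing (𝓞 E) E)ˣ | IdeleClassGroup.ideleNorm E x ∈ Set.Ioi T} = {x : (AdeleRing (𝓞 E) E)ˣ | (T : ℝ) < (IdeleClassGroup.ideleNorm E x : ℝ)} :=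
  ⟨Set.ext fun x => by simp only [Set.mem_setOf_eq, Set.mem_Iic, NNReal.coe_le_coe],
   Set.ext fun x => by simp only [Set.mem_setOf_eq, Set.mem_Ioi, NNReal.coe_lt_coe]⟩

/-- **THE TWO CUT-OFFS IN ★ FILE 2's TOKEN SHAPE** (`hδ₁…hδ₄`, `hi₁…hi₄` of ★ `maassSelberg_inner_truncation_three`), ONE constant `K` for both: for `0 < T`,
(≤) `{y | H y ≤ T}` ↦ `{x | (‖x‖:ℝ) ≤ (T:ℝ)}` under `2 < Re(a + conj a′)` (⟺ `0 < Re s`, `s + 2 = a + ā′`; finiteness = Tate at the cut-off ★ p857444 `setLIntegral_indicator_ideleNorm_rpow_eq`),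
(>) `{y | T < H y}` ↦ `{x | (T:ℝ) < (‖x‖:ℝ)}` under `Re(a + conj a′) < 2` (⟺ `0 < Re s`, `−s + 2 = a + ā′`; finiteness = the mirror ★ p857517 `setLIntegral_indicator_lt_rpow_neg`):
`(β)·(𝟙·f_a·conj f′_{a′}) ∈ L¹(ν_G)` and **`∫ (β g)·𝟙(H g)·f_a(g)·conj f′_{a′}(g) dν_G = K · ∫_𝓕 (‖x‖·‖x‖)⁻¹ • 𝟙(‖x‖)·‖x‖^{a + conj a′}·Ξ(x) dν_I`**.
[cite: MoeglinWaldspurger1995, IV.2.1] [cite: Arthur1980TraceFormulaII, §4] [cite: Garrett2018, §11.3] -/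
theorem exists_integral_weight_smul_cutoffs_flatSectionU_mul_conj_eq_three (h2 : Module.finrank F E = 2) (hc : c * c = 1) (hc1 : c ≠ 1)
    (νG : Measure (quasiSplit F E c 3).Adelic) [νG.IsHaarMeasure]
    (μK : Measure ((standardMaximalCompactGL 3 E).comap (adelicVal F E c 3 ((StdForm.antidiagonal 3).over E)) : Subgroup (quasiSplit F E c 3).Adelic))
    [μK.IsHaarMeasure]
    (νI : Measure (AdeleRing (𝓞 E) E)ˣ) [νI.IsHaarMeasure]
    (hBK : ∀ g : (quasiSplit F E c 3).Adelic, ∃ b ∈ borelAdelic F E c 3, ∃ k : (quasiSplit F E c 3).Adelic,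
      adelicVal F E c 3 ((StdForm.antidiagonal 3).over E) k ∈ standardMaximalCompactGL 3 E ∧ g = b * k)
    {𝓕 : Set (AdeleRing (𝓞 E) E)ˣ} (h𝓕 : IsIdeleClassDomain E 𝓕) :
    ∃ K : ℝ, 0 < K ∧
      (∀ {β : (quasiSplit F E c 3).Adelic → ℝ≥0∞}, IsCoveringWeight ((arithmeticBorel F E c 3).map (quasiSplit F E c 3).arithmeticSubgroup.subtype) β →
      ∀ {T : ℝ≥0}, 0 < T →
      ∀ {α α' : (quasiSplit F E c 3).Adelic → ℂ}, Measurable α → Measurable α' →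
        (∀ (n : unipotentInBorel F E c 3) (y : (quasiSplit F E c 3).Adelic), α (((n : borelAdelic F E c 3) : (quasiSplit F E c 3).Adelic) * y) = α y) →
        (∀ (n : unipotentInBorel F E c 3) (y : (quasiSplit F E c 3).Adelic), α' (((n : borelAdelic F E c 3) : (quasiSplit F E c 3).Adelic) * y) = α' y) →
        (∀ b ∈ arithmeticBorel F E c 3, ∀ y : (quasiSplit F E c 3).Adelic, α ((b : (quasiSplit F E c 3).Adelic) * y) = α y) →
        (∀ b ∈ arithmeticBorel F E c 3, ∀ y : (quasiSplit F E c 3).Adelic, α' ((b : (quasiSplit F E c 3).Adelic) * y) = α' y) →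
      ∀ {Cα Cα' : ℝ}, (∀ x, ‖α x‖ ≤ Cα) → (∀ x, ‖α' x‖ ≤ Cα') →
      ∀ {a a' : ℂ} {Ξ : (AdeleRing (𝓞 E) E)ˣ → ℂ}, Measurable Ξ → (∀ k ∈ GaloisRepresentations.principalIdeles E, ∀ x, Ξ (k * x) = Ξ x) →
        (∀ t : torusInBorel F E c 3,
          ∫ k, α (((t : borelAdelic F E c 3) : (quasiSplit F E c 3).Adelic) * (k : (quasiSplit F E c 3).Adelic)) *
              conj (α' (((t : borelAdelic F E c 3) : (quasiSplit F E c 3).Adelic) * (k : (quasiSplit F E c 3).Adelic))) ∂μK =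
            Ξ (diagUnit (t : borelAdelic F E c 3).2 0)) →
        (2 < (a + conj a').re →
          Integrable (fun g => (β g).toReal •
              ({y : (quasiSplit F E c 3).Adelic | borelHeight y ≤ T}.indicator (flatSectionU α a) g * conj (flatSectionU α' a' g))) νG ∧
            ∫ g, (β g).toReal • ({y : (quasiSplit F E c 3).Adelic | borelHeight y ≤ T}.indicator (flatSectionU α a) g * conj (flatSectionU α' a' g)) ∂νG =
              (K : ℂ) * ∫ x in 𝓕, ((IdeleClassGroup.ideleNorm E x : ℝ) * (IdeleClassGroup.ideleNorm E x : ℝ))⁻¹ •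
                {x : (AdeleRing (𝓞 E) E)ˣ | (IdeleClassGroup.ideleNorm E x : ℝ) ≤ (T : ℝ)}.indicator
                  (fun x => ((IdeleClassGroup.ideleNorm E x : ℝ) : ℂ) ^ (a + conj a') * Ξ x) x ∂νI) ∧
        ((a + conj a').re < 2 →
          Integrable (fun g => (β g).toReal •
              ({y : (quasiSplit F E c 3).Adelic | T < borelHeight y}.indicator (flatSectionU α a) g * conj (flatSectionU α' a' g))) νG ∧
            ∫ g, (β g).toReal • ({y : (quasiSplit F E c 3).Adelic | T < borelHeight y}.indicator (flatSectionU α a) g * conj (flatSectionU α' a' g)) ∂νG =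
              (K : ℂ) * ∫ x in 𝓕, ((IdeleClassGroup.ideleNorm E x : ℝ) * (IdeleClassGroup.ideleNorm E x : ℝ))⁻¹ •
                {x : (AdeleRing (𝓞 E) E)ˣ | (T : ℝ) < (IdeleClassGroup.ideleNorm E x : ℝ)}.indicator
                  (fun x => ((IdeleClassGroup.ideleNorm E x : ℝ) : ℂ) ^ (a + conj a') * Ξ x) x ∂νI)) := by
  obtain ⟨K, hK, hM⟩ := exists_integral_weight_smul_cutoff_flatSectionU_mul_conj_eq_three h2 hc hc1 νG μK νI hBK h𝓕
  refine ⟨K, hK, ?_⟩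
  intro β hβ T hT α α' hαm hα'm hαN hα'N hαB hα'B Cα Cα' hαC hα'C a a' Ξ hΞm hΞK hΞ
  have hCC : 0 ≤ Cα * Cα' := mul_nonneg ((norm_nonneg _).trans (hαC 1)) ((norm_nonneg _).trans (hα'C 1))
  have hT' : (0 : ℝ) < (T : ℝ) := NNReal.coe_pos.2 hT
  refine ⟨fun ha => ?_, fun ha => ?_⟩
  · have hfin : ∫⁻ x in 𝓕, (((IdeleClassGroup.ideleNorm E x * IdeleClassGroup.ideleNorm E x)⁻¹ : ℝ≥0) : ℝ≥0∞) *
        ({x : (AdeleRing (𝓞 E) E)ˣ | IdeleClassGroup.ideleNorm E x ∈ Set.Iic T}.indicator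
          (fun x => ENNReal.ofReal ((IdeleClassGroup.ideleNorm E x : ℝ) ^ (a + conj a').re * (Cα * Cα'))) x) ∂νI < ∞ := by
      simp_rw [normSq_inv_mul_indicator_ofReal_rpow (Set.Iic T) _ hCC]
      rw [lintegral_const_mul' _ _ ENNReal.ofReal_ne_top,
        show {x : (AdeleRing (𝓞 E) E)ˣ | IdeleClassGroup.ideleNorm E x ∈ Set.Iic T} = {x : (AdeleRing (𝓞 E) E)ˣ | IdeleClassGroup.ideleNorm E x ≤ T} from rfl,
        K2E1BorelParabolicIntegralU3.setLIntegral_indicator_ideleNorm_rpow_eq E νI h𝓕 (by linarith) T]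
      exact ENNReal.mul_lt_top ENNReal.ofReal_lt_top (ENNReal.mul_lt_top (idelicCovolume_lt_top νI) ENNReal.ofReal_lt_top)
    have h := hM hβ measurableSet_Iic hαm hα'm hαN hα'N hαB hα'B hαC hα'C hΞm hΞK hΞ hfin
    rw [(setOf_ideleNorm_mem_Iic_eq (E := E) T).1] at h
    exact h
  · have hfin : ∫⁻ x in 𝓕, (((IdeleClassGroup.ideleNorm E x * IdeleClassGroup.ideleNorm E x)⁻¹ : ℝ≥0) : ℝ≥0∞) *
        ({x : (AdeleRing (𝓞 E) E)ˣ | IdeleClassGroup.ideleNorm E x ∈ Set.Ioi T}.indicator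
          (fun x => ENNReal.ofReal ((IdeleClassGroup.ideleNorm E x : ℝ) ^ (a + conj a').re * (Cα * Cα'))) x) ∂νI < ∞ := by
      simp_rw [normSq_inv_mul_indicator_ofReal_rpow (Set.Ioi T) _ hCC]
      rw [lintegral_const_mul' _ _ ENNReal.ofReal_ne_top, (setOf_ideleNorm_mem_Iic_eq (E := E) T).2,
        show (a + conj a').re - 2 = -(2 - (a + conj a').re) by ring,
        setLIntegral_indicator_lt_rpow_neg νI (h𝓕.isFundamentalDomain νI) (by linarith) hT']
      exact ENNReal.mul_lt_top ENNReal.ofReal_lt_top (ENNReal.mul_lt_top (idelicCovolume_lt_top νI) ENNReal.ofReal_lt_top)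
    have h := hM hβ measurableSet_Ioi hαm hα'm hαN hα'N hαB hα'B hαC hα'C hΞm hΞK hΞ hfin
    rw [(setOf_ideleNorm_mem_Iic_eq (E := E) T).2] at h
    exact h

end Instances

end Summit.HodgeConjecture.HodgeConjecture.Cruxes.H413.K2E1MaassSelbergBracketsThree

end
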